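import Summits.HodgeConjecture.HodgeConjecture.Theses.TropicalWeilObstruction
import Literature.AlgebraicGeometry.Motives.HyperbolicWeilType
import Summits.HodgeConjecture.HodgeConjecture.Theorems.TropicalWeilObstructionMumfordWeilShadowWeilHodgeTriple
import Summits.HodgeConjecture.HodgeConjecture.Theorems.TropicalWeilObstructionMumfordWeilShadowExtractEffective
import HarnessLib

/-!
# Crux `MumfordWeilShadow` (stmt-HodgeConjecture-18479): the crux follows from ONE named transfer
# hypothesis — the NUMERICAL SHADOW principle of the Mumford–Weil degeneration

Route `HodgeConjecture/TropicalWeilObstruction` (a REFUTATION route: Kontsevich's tropical test,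
negative branch; this cell is a negation SINK — nothing here claims or refutes the Hodge conjecture).
Sizing file of the cell `pub-hodge-tropical` for K2 (= `MumfordWeilShadow`, XL).

STATE OF THE LINE `birth` (`Cruxes/MumfordWeilShadow/Lines/birth.lean`): of its three registered stubs,
`stub_weilHodgeTriple` (Hodge theory of hyperbolic Weil eightfolds) and `stub_extractEffective`
(linear algebra) are tree theorems; the remaining one, `stub_mumfordWeilFibre`, posits the Mumford–Weil
fibre together with an abstract specialisation MAP `ι` on classes with properties (L)/(N)/(E). This file
types the degeneration-theoretic content in the form in which the non-archimedean literature delivers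
it — as a statement about INTERSECTION NUMBERS, with no map on cohomology — and proves that it implies
the crux:

* `tropicalIntersectionPairing` — the intersection form of the tropical torus on cycle classes in
  Plücker coordinates, `β(c, c') = Σ ε(S,T) ε(S',T') c(S,S') c'(T,T')` (`ε(S,T) = det[e_S | e_T]`);
  on two cells it is `(4!)⁴ · w w' a a' · det[L | L']²`, i.e. `(4!)⁴ det Q` times the tropical
  intersection number of the cells in `ℝ⁸/Qℤ⁸` (number of intersection points of generic translates
  `a a' |det[L|L']| / det Q`, each of lattice multiplicity `|det[L|L']|`).
* `MumfordWeilNumericalShadow` — **the transfer hypothesis (T), a NAMED OPEN INPUT, not a theorem of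
  the tree and not in print as stated**: over every very general tropical Weil period `Q` there is a
  HYPERBOLIC Weil eightfold `(A, φ)` (`φ ≫ φ = -𝟙`; the very general fibre of the Mumford–Weil
  degeneration with tropical limit `X_Q = ℝ⁸/Qℤ⁸`, e.g. the Raynaud–Mumford quotient `(𝔾_m ⊗ ℤ[i]⁴)/Λ`,
  `val Λ = Qℤ⁸`, over a complete algebraically closed real-valued field of the cardinality of `ℂ`)
  and an injective functional `δ` on `H¹⁶(A(ℂ); ℂ)` (a multiple of the trace) such that EVERY FINITE
  FAMILY OF RATIONAL ALGEBRAIC `(4,4)`-CLASSES IS NUMERICALLY SHADOWED BY RATIONAL COMBINATIONS OF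
  EFFECTIVE TROPICAL `4`-CYCLES: `δ(c_k ⌣ c_{k'}) = β(v_k, v_{k'})` with `v_k = Σ_j r_{kj} · cyc Z_j`,
  `Z_j` effective tropical `4`-cycles on `X_Q`, `r ∈ ℚ`. Intended proof (paper): write `c_k = Σ_j
  r_{kj} cl(V_j)` with `V_j ⊂ A` irreducible `4`-folds; `Z_j = val(V_j^an)` is a balanced `Γ`-rational
  polyhedral complex of pure dimension `4` (Gubler 2007, Thm. 6.9), i.e. an effective tropical
  `4`-cycle; and `deg(V_j · V_{j'})` is computed tropically (Osserman–Payne 2013 for tori, locally via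
  the uniformisation; generic translation). See the cell's `K2-SIZE.md` for the census of what is in
  print and what is not.
* `mumfordWeilShadow_of_numericalShadow` — **(T) ⟹ `MumfordWeilShadow`** (the crux BY NAME): the
  Weil–Hodge triple is `stub_weilHodgeTriple`; for a cup-non-degenerate rational algebraic family
  `a₁ … a_m`, a rational relation `Σ g_k v_k = 0` among the shadows gives, by bilinearity of `β` and
  (T), `δ((Σ g_k a_k) ⌣ a_{k'}) = β(Σ g_k v_k, v_{k'}) = 0` for all `k'`, hence `g = 0` by
  non-degeneracy and injectivity of `δ`; so the shadows are `ℚ`-independent inside the `ℚ`-span of the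
  effective classes, and `exists_linearIndependent_comp_of_mem_span` extracts `m` effective tropical
  cycles with independent classes.

So, in the kernel, K2 ⟸ (T); the XL content of K2 is exactly (T). HONEST STATUS: (T) is OPEN as a
formal statement (no non-archimedean geometry, tropicalisation functor or Mumford uniformisation
exists in Mathlib or in this tree); on paper it is "folklore-expected, assembled from Gubler 2007 /
Osserman–Payne 2013 / Bosch–Lütkebohmert 1991, unpublished in this generality (value group of rational
rank 16)". Nothing here is a case of the Hodge conjecture. One definition of a pairing, one named
hypothesis, theorems otherwise; no sorry.

## References

* [Zharkov2020TropicalWeil] I. Zharkov, Tropical abelian varieties, Weil classes and the Hodge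
  conjecture, arXiv:2002.02347 (2020), pp. 2–4 (Kontsevich's specialisation scheme).
* [Gubler2007Tropical] W. Gubler, Tropical varieties for non-archimedean analytic spaces, Invent.
  Math. 169 (2007), Thm. 6.9, §6 (Mumford models over an arbitrary value group `Γ ⊂ ℝ`).
* [MikhalkinZharkov2014Eigenwave] G. Mikhalkin, I. Zharkov, Tropical eigenwave and intermediate
  Jacobians, LN UMI 15 (2014), Prop. 4.3 (cycle classes), §6 (tropical tori).
* B. Osserman, S. Payne, Lifting tropical intersections, Doc. Math. 18 (2013), Thm. 1.1.
* S. Bosch, W. Lütkebohmert, Degenerating abelian varieties, Topology 30 (1991) (algebraicity of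
  analytic tori satisfying Riemann's conditions).
-/

set_option linter.dupNamespace false

noncomputable section

open CategoryTheory
open Literature.AlgebraicGeometry Literature.AlgebraicGeometry.Motives
open Literature.AlgebraicGeometry.HodgeTheory Literature.AlgebraicGeometry.Tropical
open Literature.AlgebraicTopology.SingularHomology
open scoped BigOperators

namespace Summit.HodgeConjecture.HodgeConjecture.Theorems.MumfordWeilShadow

/-! ## §1 The tropical intersection pairing on Plücker coordinates -/

/-- The sign `ε(S, T) = det[e_{S(0)} | … | e_{S(3)} | e_{T(0)} | … | e_{T(3)}]` of the juxtaposition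
of two ordered `4`-tuples of coordinates of `ℝ⁸`: `± 1` when `(S, T)` enumerates all eight coordinates,
`0` otherwise (the structure constants of `∧ : ⋀⁴ℝ⁸ × ⋀⁴ℝ⁸ → ⋀⁸ℝ⁸ ≅ ℝ` in Plücker coordinates).
[folklore] -/
def juxtSign (S T : Fin 4 → Fin (2 * 4)) : ℝ :=
  (Matrix.of fun a b : Fin (2 * 4) =>
    if Fin.append S T (Fin.cast (by norm_num) b) = a then (1 : ℝ) else 0).det

/-- The **tropical intersection pairing** of two cycle classes of the tropical torus `ℝ⁸/Qℤ⁸` given in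
Plücker coordinates (`c, c' : (Fin 4 → Fin 8) → (Fin 4 → Fin 8) → ℝ`, the format of
`TropicalTorusCycle.cyc`): `β(c, c') = Σ_{S,S'} c(S,S') · Σ_{T,T'} ε(S,T) ε(S',T') c'(T,T')`, i.e. the
wedge `(x ∧ x') ⊗ (y ∧ y') ∈ ⋀⁸ℝ⁸ ⊗ ⋀⁸ℤ⁸ ≅ ℝ` of `x ⊗ y` and `x' ⊗ y'`. For two framed cells
`(w, a, L)`, `(w', a', L')` it equals `(4!)⁴ · w w' a a' · det[L | L']²` (Laplace expansion), which is
`(4!)⁴ · det Q` times their tropical intersection number in `ℝ⁸/Qℤ⁸`.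
[cite: MikhalkinZharkov2014Eigenwave, Prop. 4.3 and §6] -/
def tropicalIntersectionPairing (c c' : (Fin 4 → Fin (2 * 4)) → (Fin 4 → Fin (2 * 4)) → ℝ) : ℝ :=
  ∑ S, ∑ S', c S S' * ∑ T, ∑ T', juxtSign S T * juxtSign S' T' * c' T T'

/-- Kernel form of linearity: `Σ_{S,S'} (Σ_k g_k x_k)(S,S') K(S,S') = Σ_k g_k Σ_{S,S'} x_k(S,S') K(S,S')`.
[folklore] -/
theorem sum_sum_smul_mul_kernel {m : ℕ} (K : (Fin 4 → Fin (2 * 4)) → (Fin 4 → Fin (2 * 4)) → ℝ)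
    (g : Fin m → ℝ) (x : Fin m → (Fin 4 → Fin (2 * 4)) → (Fin 4 → Fin (2 * 4)) → ℝ) :
    ∑ S, ∑ S', (∑ k, g k • x k) S S' * K S S' = ∑ k, g k * ∑ S, ∑ S', x k S S' * K S S' := by
  simp only [Finset.sum_apply, Pi.smul_apply, smul_eq_mul, Finset.sum_mul, Finset.mul_sum]
  conv_rhs => rw [Finset.sum_comm]
  refine Finset.sum_congr rfl fun S _ => ?_
  rw [Finset.sum_comm]
  exact Finset.sum_congr rfl fun S' _ => Finset.sum_congr rfl fun k _ => by ring

/-- `β` is linear in its first argument: `β(Σ_k g_k • x_k, y) = Σ_k g_k β(x_k, y)`. [folklore] -/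
theorem tropicalIntersectionPairing_sum_smul_left {m : ℕ} (g : Fin m → ℝ)
    (x : Fin m → (Fin 4 → Fin (2 * 4)) → (Fin 4 → Fin (2 * 4)) → ℝ)
    (y : (Fin 4 → Fin (2 * 4)) → (Fin 4 → Fin (2 * 4)) → ℝ) :
    tropicalIntersectionPairing (∑ k, g k • x k) y = ∑ k, g k * tropicalIntersectionPairing (x k) y := by
  unfold tropicalIntersectionPairing
  exact sum_sum_smul_mul_kernel (fun S S' => ∑ T, ∑ T', juxtSign S T * juxtSign S' T' * y T T') g x

/-- `β(0, y) = 0`. [folklore] -/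
theorem tropicalIntersectionPairing_zero_left (y : (Fin 4 → Fin (2 * 4)) → (Fin 4 → Fin (2 * 4)) → ℝ) :
    tropicalIntersectionPairing 0 y = 0 := by
  simp [tropicalIntersectionPairing]

/-! ## §2 The transfer hypothesis (T): numerical shadows of algebraic classes -/

/-- **(T) `MumfordWeilNumericalShadow` — NAMED OPEN TRANSFER HYPOTHESIS (not a theorem of the tree, not
in print as stated).** For every positive definite `Q` commuting with `J = weilJ 4` whose `16` free
entries are algebraically independent over `ℚ` there are a complex abelian eightfold `A`,
`φ : A ⟶ A` with `φ ≫ φ = -𝟙`, a projective embedding `e` and a non-zero rational `a ∈ H²(ℙᴺ(ℂ); ℂ)`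
with `(A, φ)` HYPERBOLIC for `e^*a + φ^*e^*a`, and an injective linear functional `δ` on
`H¹⁶(A(ℂ); ℂ)`, such that every finite family `c₁, …, c_m` of rational algebraic classes in
`H⁸(A(ℂ); ℂ)` is NUMERICALLY SHADOWED by rational combinations `v_k = Σ_j r_{kj} · cyc Z_j` of classes
of effective tropical `4`-cycles `Z_j` on `ℝ⁸/Qℤ⁸`: `δ(c_k ⌣ c_{k'}) = β(v_k, v_{k'})` for all
`k, k'`. Intended witness: the Mumford–Weil fibre over `Q` (Raynaud–Mumford quotient
`(𝔾_m ⊗ ℤ[i]⁴)/Λ`, `val Λ = Qℤ⁸`, over a complete algebraically closed real-valued field of value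
group `⊇ Σ ℤ Q_{ab}`, transported to `ℂ`), `Z_j` the tropicalisations of irreducible subvarieties
representing the `c_k` (Gubler 2007, Thm. 6.9), `δ = (4!)⁴ det Q ·` trace, and the equality =
"tropicalisation preserves intersection numbers" (Osserman–Payne 2013 locally in the uniformising
torus). [cite: Zharkov2020TropicalWeil, pp. 2–4] -/
@[conjecture] def MumfordWeilNumericalShadow : Prop :=
  ∀ Q : Matrix (Fin (2 * 4)) (Fin (2 * 4)) ℝ, Q.PosDef → Q * weilJ 4 = weilJ 4 * Q →
    IsWeilGeneric 4 Q →
    ∃ (A : AbelianVariety ℂ) (φ : A ⟶ A) (e : ProjectiveEmbedding A.X)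
      (a : complexBetti (projectiveSpace e.n ℂ) 2) (δ : complexBetti A.X 16 →ₗ[ℂ] ℂ),
      A.dim = 8 ∧ φ ≫ φ = -(𝟙 A) ∧ IsRationalClass a ∧ a ≠ 0 ∧
      IsHyperbolicWeilType A φ 4
        (complexBetti.map e.ι 2 a + complexBetti.map φ.hom.hom.hom 2 (complexBetti.map e.ι 2 a)) ∧
      Function.Injective δ ∧
      ∀ (m : ℕ) (c : Fin m → complexBetti A.X (2 * 4)),
        (∀ k, IsRationalClass (c k)) → (∀ k, c k ∈ algebraicClasses A.X 4) →
        ∃ (N : ℕ) (Z : Fin N → TropicalTorusCycle (2 * 4) 4 Q) (r : Fin m → Fin N → ℚ),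
          ∀ k k', δ (cupProduct (show 2 * 4 + 2 * 4 = 16 by norm_num) (c k) (c k')) =
            ((tropicalIntersectionPairing (∑ j, ((r k j : ℚ) : ℝ) • (Z j).cyc)
              (∑ j, ((r k' j : ℚ) : ℝ) • (Z j).cyc) : ℝ) : ℂ)

/-! ## §3 (T) implies the crux -/

/-- **`MumfordWeilNumericalShadow` ⟹ `MumfordWeilShadow`** (the crux of item stmt-HodgeConjecture-18479,
BY NAME). Take the hyperbolic Weil eightfold `(A, φ)` of (T) over `Q` and its Weil–Hodge triple
(`stub_weilHodgeTriple`). For a cup-non-degenerate rational algebraic family `a₁, …, a_m` with shadows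
`v_k = Σ_j r_{kj} cyc Z_j`: if `Σ_k g_k v_k = 0` with `g ∈ ℚ^m`, then for every `k'`,
`δ((Σ_k g_k a_k) ⌣ a_{k'}) = Σ_k g_k β(v_k, v_{k'}) = β(Σ_k g_k v_k, v_{k'}) = 0`, so
`(Σ g_k a_k) ⌣ a_{k'} = 0` (`δ` injective) and `g = 0` by non-degeneracy. Hence the `v_k` are
`ℚ`-linearly independent members of the `ℚ`-span of the effective classes, and extraction
(`exists_linearIndependent_comp_of_mem_span`) yields `m` effective tropical `4`-cycles with
`ℚ`-independent classes. [cite: Zharkov2020TropicalWeil, pp. 2–4] -/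
theorem mumfordWeilShadow_of_numericalShadow (hT : MumfordWeilNumericalShadow) :
    Theses.TropicalWeilObstruction.MumfordWeilShadow := by
  intro Q hQ hQJ hgen
  obtain ⟨A, φ, e, a, δ, hdim, hφ, ha, ha0, hhyp, hδ, hsh⟩ := hT Q hQ hQJ hgen
  obtain ⟨u, hu, hu1, hu2, hund⟩ := stub_weilHodgeTriple A φ e a hdim hφ ha ha0 hhyp
  refine ⟨A, φ, u, hdim, hφ, hu, hu1, hu2, hund, ?_⟩
  intro m a' hrat halg hnd
  obtain ⟨N, Z, r, hgram⟩ := hsh m a' hrat halg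
  -- the shadows `v_k = Σ_j r_{kj} • cyc Z_j`
  set v : Fin m → (Fin 4 → Fin (2 * 4)) → (Fin 4 → Fin (2 * 4)) → ℝ :=
    fun k => ∑ j, ((r k j : ℚ) : ℝ) • (Z j).cyc with hv
  have hmem : ∀ k, v k ∈ Submodule.span ℚ (Set.range
      (TropicalTorusCycle.cyc : TropicalTorusCycle (2 * 4) 4 Q →
        (Fin 4 → Fin (2 * 4)) → (Fin 4 → Fin (2 * 4)) → ℝ)) := by
    intro k
    refine Submodule.sum_mem _ fun j _ => ?_
    rw [Rat.cast_smul_eq_qsmul ℝ (r k j)]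
    exact Submodule.smul_mem _ _ (Submodule.subset_span ⟨Z j, rfl⟩)
  have hli : LinearIndependent ℚ v := by
    rw [Fintype.linearIndependent_iff]
    intro g hg
    by_contra hne
    push Not at hne
    obtain ⟨k₀, hk₀⟩ := hne
    have hg0 : g ≠ 0 := fun h => hk₀ (by simp [h])
    obtain ⟨k', hk'⟩ := hnd g hg0
    apply hk'
    -- `δ ((Σ g_k a_k) ⌣ a_{k'}) = β (Σ g_k v_k, v_{k'}) = 0`
    have hzero : ∑ k, ((g k : ℚ) : ℝ) • v k = 0 := by
      have e : ∑ k, ((g k : ℚ) : ℝ) • v k = ∑ k, g k • v k :=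
        Finset.sum_congr rfl fun k _ => Rat.cast_smul_eq_qsmul ℝ (g k) (v k)
      rw [e, hg]
    have hδ0 : δ (cupProduct (show 2 * 4 + 2 * 4 = 16 by norm_num)
        (∑ k, ((g k : ℚ) : ℂ) • a' k) (a' k')) = 0 := by
      rw [map_sum, LinearMap.sum_apply, map_sum]
      simp_rw [map_smul, LinearMap.smul_apply, map_smul, smul_eq_mul, hgram]
      have hcast : ∑ k, ((g k : ℚ) : ℂ) *
          ((tropicalIntersectionPairing (v k) (v k') : ℝ) : ℂ) =
          ((∑ k, ((g k : ℚ) : ℝ) * tropicalIntersectionPairing (v k) (v k') : ℝ) : ℂ) := by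
        push_cast
        rfl
      rw [hcast, ← tropicalIntersectionPairing_sum_smul_left, hzero,
        tropicalIntersectionPairing_zero_left, Complex.ofReal_zero]
    exact hδ (by rw [hδ0, map_zero])
  exact exists_linearIndependent_comp_of_mem_span TropicalTorusCycle.cyc hli hmem

end Summit.HodgeConjecture.HodgeConjecture.Theorems.MumfordWeilShadow

end
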